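import Summits.SmoothPoincare4.SmoothPoincare4.Theorems.SymplecticOrigamiFoldedSphereFoldExistenceCrossProduct
import Literature.Topology.FourManifolds.ParallelizablePullback
import Literature.Topology.FourManifolds.Spin
import Literature.Topology.FourManifolds.SmoothOrientation
import Mathlib.Geometry.Manifold.ContMDiffMFDeriv

/-!
# An immersion `M⁴ ↬ ℝ⁵` of an oriented 4-manifold gives a stable framing

Route `SmoothPoincare4/SymplecticOrigami`, support item `FoldedSphereFoldExistence`
(stmt-SmoothPoincare4-14076). Classical fact (Hirsch–Smale; Milnor–Stasheff §11: the normal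
bundle of a codimension-one immersion of an oriented manifold into `ℝⁿ⁺¹` is trivial, hence
`TM ⊕ ℝ ≅ f*Tℝⁿ⁺¹` is trivial), in the tree's language of stable framings
(`Literature.Topology.FourManifolds.IsStablyParallelizable`, `Spin.lean`):

* `exists_stableFrame_of_immersion` — **an oriented `C¹` 4-manifold admitting a `C¹` map into
  a 5-dimensional real normed space with everywhere injective differential carries five
  continuous, pointwise linearly independent sections of `TM ⊕ ℝ`**: with `ν(p) = ±` the
  normalised generalized cross product of `dF_p(e₀),…,dF_p(e₃)` (sign from the orientation, so
  that `ν` is continuous: two charts change the cross product by `det` of the tangent coordinate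
  change and the orientation by its sign), the isomorphisms `G_p(w, t) = dF_p w + t ν(p) :
  T_pM × ℝ ≅ ℝ⁵` pull the constant frame back.

Sequel `…ImmersionR5KM31.lean`: `IsStablyParallelizable`, and with
`exists_immersion_prodReal_of_foldMap` (Gromov PDR 2.1.3 (C″)) the named fact
`Literature.Topology.FourManifolds.eliashberg_foldMap_homotopySphere_four` implies the open
hypothesis `h31 : ∀ S : HomotopySphere 4, IsStablyParallelizable (𝓡 4) S.carrier` of
`Literature.Barriers.SmoothPoincare4.stableBarrierFour_of_kervaireMilnorFrontier`
(Kervaire–Milnor 1963, Thm. 3.1, `n = 4`).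
-/

noncomputable section

-- the prescribed namespace `Summit.<P>.<Sub>.…` duplicates `SmoothPoincare4` (P = Sub)
set_option linter.dupNamespace false

open scoped Manifold ContDiff Topology
open Set Function Bundle Module
open Literature.Topology.FourManifolds

namespace Summit.SmoothPoincare4.SmoothPoincare4.Theorems.FoldedSphereFoldExistence

variable {N : Type*} [TopologicalSpace N] [ChartedSpace (EuclideanSpace ℝ (Fin 4)) N]

/-! ### Stable framing from a codimension-one immersion of an oriented 4-manifold -/

/-- The map `v ↦ (t ↦ t • v)` into rank-one operators is continuous (a linear map out of a
finite-dimensional space). [folklore] -/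
theorem continuous_smulRight_one {V : Type*} [NormedAddCommGroup V] [NormedSpace ℝ V]
    [FiniteDimensional ℝ V] :
    Continuous fun v : V => (1 : ℝ →L[ℝ] ℝ).smulRight v := by
  set L : V →ₗ[ℝ] (ℝ →L[ℝ] V) :=
    { toFun := fun v => (1 : ℝ →L[ℝ] ℝ).smulRight v
      map_add' := fun v w => by
        apply ContinuousLinearMap.ext_ring
        simp
      map_smul' := fun r v => by
        apply ContinuousLinearMap.ext_ring
        simp } with hL
  exact L.continuous_of_finiteDimensional

/-- **A `C¹` immersion of an oriented 4-manifold into a 5-dimensional real normed space gives a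
stable framing** (`TM ⊕ ℝ` trivial: Hirsch, *Differential Topology*, Ch. 4; Milnor–Stasheff,
*Characteristic Classes*, §11, triviality of the normal line bundle of a codimension-one
immersion of an oriented manifold). With `b` a basis of `V`, `e` the standard basis of `ℝ⁴`,
`A_p = dF_p`, `c(p) = Σⱼ det_b(bⱼ, A_p e₀, …, A_p e₃) bⱼ` the generalized cross product and
`σ(p) = ±1` according as the orientation `o p` is the reference orientation of `ℝ⁴` or not, the
unit normal `ν(p) = (σ(p)/‖c(p)‖) c(p)` is continuous (in the trivialisation at `p₀` both the
cross product and `σ` change by the sign of `det` of the tangent coordinate change,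
`SmoothOrientation.eventually_eq_iff`), the maps `G_p(w, t) = A_p w + t ν(p)` are linear
isomorphisms `ℝ⁴ × ℝ ≅ V`, and `sᵢ(p) = G_p⁻¹(bᵢ)` are five continuous, pointwise linearly
independent sections of `TM ⊕ ℝ`. [cite: Hirsch1976, Ch. 4 §2] -/
theorem exists_stableFrame_of_immersion [IsManifold (𝓡 4) ∞ N]
    {V : Type*} [NormedAddCommGroup V] [NormedSpace ℝ V] [FiniteDimensional ℝ V]
    (o : SmoothOrientation (𝓡 4) N) (b : Basis (Fin 5) ℝ V) {F : N → V}
    (hF : ContMDiff (𝓡 4) 𝓘(ℝ, V) 1 F)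
    (hinj : ∀ x, Injective (mfderiv (𝓡 4) 𝓘(ℝ, V) F x)) :
    ∃ s : Fin 5 → N → (EuclideanSpace ℝ (Fin 4)) × ℝ,
      (∀ i, Continuous fun p => (TotalSpace.mk' (EuclideanSpace ℝ (Fin 4)) p (s i p).1 :
        TangentBundle (𝓡 4) N)) ∧
      (∀ i, Continuous fun p => (s i p).2) ∧ ∀ p, LinearIndependent ℝ fun i => s i p := by
  classical
  haveI : CompleteSpace V := FiniteDimensional.complete ℝ V
  have hV : finrank ℝ V = 5 := by simpa using finrank_eq_card_basis b
  -- the standard basis of `ℝ⁴`, the reference orientation, the sign `σ`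
  set e : Basis (Fin 4) ℝ (EuclideanSpace ℝ (Fin 4)) := (EuclideanSpace.basisFun (Fin 4) ℝ).toBasis
    with he
  set ω₀ : Orientation ℝ (EuclideanSpace ℝ (Fin 4)) (Fin (finrank ℝ (EuclideanSpace ℝ (Fin 4)))) :=
    (Module.finBasis ℝ (EuclideanSpace ℝ (Fin 4))).orientation with hω₀
  set σ : N → ℝ := fun p => if o p = ω₀ then 1 else -1 with hσ
  have hσ1 : ∀ p, σ p = 1 ∨ σ p = -1 := fun p => by
    by_cases h : o p = ω₀
    · exact Or.inl (if_pos h)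
    · exact Or.inr (if_neg h)
  have hσne : ∀ p, σ p ≠ 0 := fun p => by rcases hσ1 p with h | h <;> simp [h]
  have hcard : Fintype.card (Fin (finrank ℝ (EuclideanSpace ℝ (Fin 4)))) =
      finrank ℝ (EuclideanSpace ℝ (Fin 4)) := Fintype.card_fin _
  have hω₀ne : ω₀ ≠ -ω₀ := Module.Ray.ne_neg_self ω₀
  -- two orientations differ iff their signs differ
  have hkey : ∀ r, (σ r = 1 ∧ o r = ω₀) ∨ (σ r = -1 ∧ o r = -ω₀) := fun r => by
    rcases Orientation.eq_or_eq_neg (o r) ω₀ hcard with h | h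
    · exact Or.inl ⟨if_pos h, h⟩
    · refine Or.inr ⟨if_neg ?_, h⟩
      rw [h]
      exact fun h' => hω₀ne h'.symm
  have hσeq : ∀ p q, σ p = σ q ↔ o p = o q := by
    intro p q
    rcases hkey p with ⟨hp1, hp2⟩ | ⟨hp1, hp2⟩ <;> rcases hkey q with ⟨hq1, hq2⟩ | ⟨hq1, hq2⟩
    · simp [hp1, hq1, hp2, hq2]
    · rw [hp1, hq1, hp2, hq2]
      constructor
      · intro h; norm_num at h
      · intro h; exact absurd h hω₀ne
    · rw [hp1, hq1, hp2, hq2]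
      constructor
      · intro h; norm_num at h
      · intro h; exact absurd h.symm hω₀ne
    · simp [hp1, hq1, hp2, hq2]
  -- the differential, the frame `a`, the cross product `c`, the unit normal `ν`, the isomorphism `G`
  set A : N → (EuclideanSpace ℝ (Fin 4)) →L[ℝ] V := fun p => mfderiv (𝓡 4) 𝓘(ℝ, V) F p with hA
  set a : N → Fin 4 → V := fun p i => A p (e i) with ha
  set c : N → V := fun p => ∑ j, b.det (Matrix.vecCons (b j) (a p)) • b j with hc
  set ν : N → V := fun p => (σ p / ‖c p‖) • c p with hν
  set G : N → ((EuclideanSpace ℝ (Fin 4)) × ℝ →L[ℝ] V) := fun p =>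
    (A p).comp (ContinuousLinearMap.fst ℝ (EuclideanSpace ℝ (Fin 4)) ℝ) +
      ((1 : ℝ →L[ℝ] ℝ).smulRight (ν p)).comp (ContinuousLinearMap.snd ℝ (EuclideanSpace ℝ (Fin 4)) ℝ)
    with hG
  have hGapply : ∀ p (z : (EuclideanSpace ℝ (Fin 4)) × ℝ), G p z = A p z.1 + z.2 • ν p := by
    intro p z
    simp [hG]
  -- pointwise: `a p` is linearly independent, `c p ≠ 0`, `G p` is invertible
  have hali : ∀ p, LinearIndependent ℝ (a p) := fun p => by
    have h1 : LinearIndependent ℝ ((A p : (EuclideanSpace ℝ (Fin 4)) →ₗ[ℝ] V) ∘ e) :=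
      e.linearIndependent.map' _ (LinearMap.ker_eq_bot.2 (hinj p))
    exact h1
  have hcne : ∀ p, c p ≠ 0 := fun p h0 => by
    have h1 := det_vecCons_cross_pos b (hali p)
    rw [show (∑ j, b.det (Matrix.vecCons (b j) (a p)) • b j) = c p from rfl, h0,
      b.det.map_coord_zero (m := Matrix.vecCons (0 : V) (a p)) 0 rfl] at h1
    exact lt_irrefl 0 h1
  have hAsum : ∀ p (w : EuclideanSpace ℝ (Fin 4)), A p w = ∑ i, w i • a p i := by
    intro p w
    have hw : w = ∑ i, w i • e i := by
      conv_lhs => rw [← e.sum_repr w]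
      simp [he]
    conv_lhs => rw [hw]
    simp [map_sum, map_smul, ha]
  have hGinj : ∀ p, Injective (G p) := by
    intro p z z' hzz'
    rw [← sub_eq_zero]
    set d := z - z' with hd
    have hd0 : G p d = 0 := by rw [hd, map_sub, sub_eq_zero]; exact hzz'
    rw [hGapply, hAsum] at hd0
    -- coefficients on the independent family `(c p, a p)`
    have hli := linearIndependent_vecCons_cross b (hali p)
    set g : Fin 5 → ℝ := Matrix.vecCons (d.2 * (σ p / ‖c p‖)) (fun i => d.1 i) with hg
    have hsum : ∑ k, g k • Matrix.vecCons (∑ j, b.det (Matrix.vecCons (b j) (a p)) • b j) (a p) k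
        = 0 := by
      rw [Fin.sum_univ_succ]
      simp only [hg, Matrix.cons_val_zero, Matrix.cons_val_succ]
      rw [show (∑ j, b.det (Matrix.vecCons (b j) (a p)) • b j) = c p from rfl, mul_smul,
        add_comm]
      exact hd0
    have hg0 := (Fintype.linearIndependent_iff.1 hli) g hsum
    have h2 : d.2 = 0 := by
      have h := hg0 0
      simp only [hg, Matrix.cons_val_zero] at h
      rcases mul_eq_zero.1 h with h | h
      · exact h
      · exact absurd h (div_ne_zero (hσne p) (norm_ne_zero_iff.2 (hcne p)))
    have h1 : d.1 = 0 := by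
      ext i
      have h := hg0 i.succ
      simp only [hg, Matrix.cons_val_succ] at h
      simpa using h
    exact Prod.ext h1 h2
  have hdim : finrank ℝ ((EuclideanSpace ℝ (Fin 4)) × ℝ) = finrank ℝ V := by
    rw [finrank_prod, hV]; simp
  have hGinv : ∀ p, (G p).IsInvertible := fun p =>
    ⟨(LinearMap.linearEquivOfInjective (G p : ((EuclideanSpace ℝ (Fin 4)) × ℝ) →ₗ[ℝ] V)
      (hGinj p) hdim).toContinuousLinearEquiv, ContinuousLinearMap.ext fun z => rfl⟩
  -- the local analysis at a point `p₀`: a continuous `G̃` inverting the sections in the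
  -- trivialisation at `p₀`
  have hloc : ∀ p₀ : N, ∃ Gt : N → ((EuclideanSpace ℝ (Fin 4)) × ℝ →L[ℝ] V),
      ContinuousAt Gt p₀ ∧ (Gt p₀).IsInvertible ∧
        ∀ᶠ p in 𝓝 p₀, ∀ z : (EuclideanSpace ℝ (Fin 4)) × ℝ,
          Gt p (tangentCoordChange (𝓡 4) p p₀ p z.1, z.2) = G p z := by
    intro p₀
    -- the differential in the trivialisation at `p₀`
    set B : N → (EuclideanSpace ℝ (Fin 4)) →L[ℝ] V :=
      inTangentCoordinates (𝓡 4) 𝓘(ℝ, V) id F (fun p => mfderiv (𝓡 4) 𝓘(ℝ, V) F p) p₀ with hB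
    have hBc : ContinuousAt B p₀ :=
      ((hF p₀).mfderiv_const (m := 0) le_rfl).continuousAt
    have hmem : ∀ᶠ p in 𝓝 p₀, p ∈ (extChartAt (𝓡 4) p₀).source := by
      rw [extChartAt_source]
      exact (chartAt _ p₀).open_source.mem_nhds (mem_chart_source _ p₀)
    -- `B p = A p ∘ T'_p`, `A p = B p ∘ T_p`
    have hBA : ∀ᶠ p in 𝓝 p₀, ∀ v, B p v = A p (tangentCoordChange (𝓡 4) p₀ p p v) := by
      filter_upwards [hmem] with p hp v
      have hp' : id p ∈ (chartAt (EuclideanSpace ℝ (Fin 4)) (id p₀)).source := by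
        rwa [extChartAt_source] at hp
      rw [hB, inTangentCoordinates_eq _ _ _ hp' (by simp)]
      simp only [ContinuousLinearMap.comp_apply, tangentBundleCore_coordChange_model_space,
        ContinuousLinearMap.id_apply]
      rfl
    have hTT : ∀ᶠ p in 𝓝 p₀, ∀ v : EuclideanSpace ℝ (Fin 4),
        tangentCoordChange (𝓡 4) p₀ p p (tangentCoordChange (𝓡 4) p p₀ p v) = v ∧
        tangentCoordChange (𝓡 4) p p₀ p (tangentCoordChange (𝓡 4) p₀ p p v) = v := by
      filter_upwards [hmem] with p hp v
      have hpp : p ∈ (extChartAt (𝓡 4) p).source := mem_extChartAt_source p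
      constructor
      · rw [tangentCoordChange_comp ⟨⟨hpp, hp⟩, hpp⟩, tangentCoordChange_self hpp]
      · rw [tangentCoordChange_comp ⟨⟨hp, hpp⟩, hp⟩, tangentCoordChange_self hp]
    have hAB : ∀ᶠ p in 𝓝 p₀, ∀ v, A p v = B p (tangentCoordChange (𝓡 4) p p₀ p v) := by
      filter_upwards [hBA, hTT] with p hp hT v
      rw [hp, (hT v).1]
    -- `det T_p ≠ 0`
    have hdet : ∀ᶠ p in 𝓝 p₀, LinearMap.det ((tangentCoordChange (𝓡 4) p p₀ p :
        (EuclideanSpace ℝ (Fin 4)) →L[ℝ] (EuclideanSpace ℝ (Fin 4))) :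
          (EuclideanSpace ℝ (Fin 4)) →ₗ[ℝ] (EuclideanSpace ℝ (Fin 4))) ≠ 0 := by
      filter_upwards [hTT] with p hT
      intro h0
      have hcomp : ((tangentCoordChange (𝓡 4) p₀ p p :
          (EuclideanSpace ℝ (Fin 4)) →L[ℝ] (EuclideanSpace ℝ (Fin 4))) :
            (EuclideanSpace ℝ (Fin 4)) →ₗ[ℝ] (EuclideanSpace ℝ (Fin 4))).comp
          ((tangentCoordChange (𝓡 4) p p₀ p :
            (EuclideanSpace ℝ (Fin 4)) →L[ℝ] (EuclideanSpace ℝ (Fin 4))) :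
              (EuclideanSpace ℝ (Fin 4)) →ₗ[ℝ] (EuclideanSpace ℝ (Fin 4))) = LinearMap.id :=
        LinearMap.ext fun v => (hT v).1
      have h1 := congrArg LinearMap.det hcomp
      rw [LinearMap.det_comp, LinearMap.det_id, h0, mul_zero] at h1
      exact zero_ne_one h1
    -- the cross product in the trivialisation and its relation to `c`
    set c' : N → V := fun p => ∑ j, b.det (Matrix.vecCons (b j) (fun i => B p (e i))) • b j with hc'
    have hcc' : ∀ᶠ p in 𝓝 p₀, c p = LinearMap.det ((tangentCoordChange (𝓡 4) p p₀ p :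
        (EuclideanSpace ℝ (Fin 4)) →L[ℝ] (EuclideanSpace ℝ (Fin 4))) :
          (EuclideanSpace ℝ (Fin 4)) →ₗ[ℝ] (EuclideanSpace ℝ (Fin 4))) • c' p := by
      filter_upwards [hAB] with p hp
      have h1 : a p = fun i => (B p : (EuclideanSpace ℝ (Fin 4)) →ₗ[ℝ] V)
          (((tangentCoordChange (𝓡 4) p p₀ p : (EuclideanSpace ℝ (Fin 4)) →L[ℝ] _) :
            (EuclideanSpace ℝ (Fin 4)) →ₗ[ℝ] _) (e i)) := by
        funext i
        exact hp (e i)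
      show (∑ j, b.det (Matrix.vecCons (b j) (a p)) • b j) = _
      rw [h1, cross_comp_eq_det_smul b e]
      rfl
    -- continuity of `c'` at `p₀` and `c' p₀ ≠ 0`
    have hc'c : ContinuousAt c' p₀ := by
      have h1 : ContinuousAt (fun p => fun i => B p (e i)) p₀ :=
        continuousAt_pi.2 fun i => hBc.clm_apply continuousAt_const
      exact tendsto_finsetSum _ fun j _ =>
        (((continuous_det_vecCons b (b j)).continuousAt.comp h1).smul
          (continuousAt_const (y := b j)) : _)
    have hc'0 : c' p₀ ≠ 0 := by
      intro h0
      have h1 := hcc'.self_of_nhds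
      rw [h0, smul_zero] at h1
      exact hcne p₀ h1
    -- `σ p · det T_p = σ p₀ · |det T_p|` near `p₀` (the orientation axiom)
    have hσdet : ∀ᶠ p in 𝓝 p₀, σ p * LinearMap.det ((tangentCoordChange (𝓡 4) p p₀ p :
        (EuclideanSpace ℝ (Fin 4)) →L[ℝ] (EuclideanSpace ℝ (Fin 4))) :
          (EuclideanSpace ℝ (Fin 4)) →ₗ[ℝ] (EuclideanSpace ℝ (Fin 4))) =
        σ p₀ * |LinearMap.det ((tangentCoordChange (𝓡 4) p p₀ p :
          (EuclideanSpace ℝ (Fin 4)) →L[ℝ] (EuclideanSpace ℝ (Fin 4))) :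
            (EuclideanSpace ℝ (Fin 4)) →ₗ[ℝ] (EuclideanSpace ℝ (Fin 4)))| := by
      filter_upwards [o.eventually_eq_iff p₀, hdet] with p hp hd
      rcases lt_or_gt_of_ne hd with hlt | hgt
      · -- negative determinant: opposite orientations, opposite signs
        have hne : o p ≠ o p₀ := fun h => absurd (hp.1 h) (not_lt.2 hlt.le)
        have hσ' : σ p = -σ p₀ := by
          rcases hσ1 p with h1 | h1 <;> rcases hσ1 p₀ with h2 | h2
          · exact absurd ((hσeq p p₀).1 (h1.trans h2.symm)) hne
          · rw [h1, h2]; norm_num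
          · rw [h1, h2]
          · exact absurd ((hσeq p p₀).1 (h1.trans h2.symm)) hne
        rw [hσ', abs_of_neg hlt, neg_mul, mul_neg]
      · have heq : o p = o p₀ := hp.2 hgt
        rw [(hσeq p p₀).2 heq, abs_of_pos hgt]
    -- `ν = (σ p₀ / ‖c'‖) c'` near `p₀`, hence `ν` is continuous at `p₀`
    have hνeq : ∀ᶠ p in 𝓝 p₀, ν p = (σ p₀ / ‖c' p‖) • c' p := by
      filter_upwards [hcc', hσdet, hdet] with p hp hs hd
      set d : ℝ := LinearMap.det ((tangentCoordChange (𝓡 4) p p₀ p :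
        (EuclideanSpace ℝ (Fin 4)) →L[ℝ] (EuclideanSpace ℝ (Fin 4))) :
          (EuclideanSpace ℝ (Fin 4)) →ₗ[ℝ] (EuclideanSpace ℝ (Fin 4))) with hd'
      have hc'p : c' p ≠ 0 := by
        intro h0
        rw [h0, smul_zero] at hp
        exact hcne p hp
      have hnorm : ‖c p‖ = |d| * ‖c' p‖ := by rw [hp, norm_smul, Real.norm_eq_abs]
      show (σ p / ‖c p‖) • c p = (σ p₀ / ‖c' p‖) • c' p
      rw [hnorm, hp, smul_smul]
      congr 1
      have h2 : |d| ≠ 0 := abs_ne_zero.2 hd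
      calc σ p / (|d| * ‖c' p‖) * d = (σ p * d) / (|d| * ‖c' p‖) := by ring
        _ = (σ p₀ * |d|) / (|d| * ‖c' p‖) := by rw [hs]
        _ = σ p₀ / ‖c' p‖ := by rw [mul_comm |d| ‖c' p‖]; exact mul_div_mul_right _ _ h2
    have hνc : ContinuousAt ν p₀ := by
      have h1 : ContinuousAt (fun p => (σ p₀ / ‖c' p‖) • c' p) p₀ :=
        (continuousAt_const.div hc'c.norm (norm_ne_zero_iff.2 hc'0)).smul hc'c
      exact h1.congr (Filter.EventuallyEq.symm hνeq)
    -- the isomorphism in the trivialisation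
    set Gt : N → ((EuclideanSpace ℝ (Fin 4)) × ℝ →L[ℝ] V) := fun p =>
      (B p).comp (ContinuousLinearMap.fst ℝ (EuclideanSpace ℝ (Fin 4)) ℝ) +
        ((1 : ℝ →L[ℝ] ℝ).smulRight (ν p)).comp
          (ContinuousLinearMap.snd ℝ (EuclideanSpace ℝ (Fin 4)) ℝ) with hGt
    have hGtc : ContinuousAt Gt p₀ :=
      (hBc.clm_comp continuousAt_const).add
        ((continuous_smulRight_one.continuousAt.comp hνc).clm_comp continuousAt_const)
    have hGtG : ∀ᶠ p in 𝓝 p₀, ∀ z : (EuclideanSpace ℝ (Fin 4)) × ℝ,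
        Gt p (tangentCoordChange (𝓡 4) p p₀ p z.1, z.2) = G p z := by
      filter_upwards [hAB] with p hp
      intro z
      rw [hGapply]
      simp [hGt, hp z.1]
    have hGt0 : Gt p₀ = G p₀ := by
      refine ContinuousLinearMap.ext fun z => ?_
      have h := hGtG.self_of_nhds z
      rw [tangentCoordChange_self (mem_extChartAt_source p₀), Prod.mk.eta] at h
      exact h
    refine ⟨Gt, hGtc, by rw [hGt0]; exact hGinv p₀, hGtG⟩
  -- near `p₀` the sections read `G̃_p⁻¹ bᵢ` in the trivialisation at `p₀`
  have hread : ∀ (i : Fin 5) (p₀ : N), ∃ Gt : N → ((EuclideanSpace ℝ (Fin 4)) × ℝ →L[ℝ] V),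
      ContinuousAt (fun p => (Gt p).inverse (b i)) p₀ ∧
        ∀ᶠ p in 𝓝 p₀, (tangentCoordChange (𝓡 4) p p₀ p ((G p).inverse (b i)).1,
          ((G p).inverse (b i)).2) = (Gt p).inverse (b i) := by
    intro i p₀
    obtain ⟨Gt, hGtc, hGt0, hGtG⟩ := hloc p₀
    obtain ⟨E₀, hE₀⟩ := hGt0
    have hinvc : ContinuousAt (fun p => (Gt p).inverse (b i)) p₀ := by
      have h1 : ContinuousAt ContinuousLinearMap.inverse (Gt p₀) := by
        rw [← hE₀]
        exact (contDiffAt_map_inverse (n := 0) E₀).continuousAt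
      exact (h1.comp hGtc).clm_apply continuousAt_const
    have hGtinv : ∀ᶠ p in 𝓝 p₀, (Gt p).IsInvertible := by
      have hopen : IsOpen {f : (EuclideanSpace ℝ (Fin 4)) × ℝ →L[ℝ] V | f.IsInvertible} := by
        convert ContinuousLinearEquiv.isOpen (𝕜 := ℝ) (E := (EuclideanSpace ℝ (Fin 4)) × ℝ)
          (F := V) using 1
        ext f
        simp only [mem_setOf_eq, ContinuousLinearMap.IsInvertible, mem_range]
      exact hGtc.preimage_mem_nhds (hopen.mem_nhds ⟨E₀, hE₀⟩)
    refine ⟨Gt, hinvc, ?_⟩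
    filter_upwards [hGtG, hGtinv] with p hp hpinv
    have h1 : Gt p (tangentCoordChange (𝓡 4) p p₀ p ((G p).inverse (b i)).1,
        ((G p).inverse (b i)).2) = b i := by
      rw [hp]
      exact (hGinv p).self_apply_inverse (b i)
    calc (tangentCoordChange (𝓡 4) p p₀ p ((G p).inverse (b i)).1, ((G p).inverse (b i)).2)
        = (Gt p).inverse (Gt p (tangentCoordChange (𝓡 4) p p₀ p ((G p).inverse (b i)).1,
            ((G p).inverse (b i)).2)) := (hpinv.inverse_apply_self _).symm
      _ = (Gt p).inverse (b i) := by rw [h1]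
  -- the sections
  refine ⟨fun i p => (G p).inverse (b i), fun i => ?_, fun i => ?_, fun p => ?_⟩
  rotate_left 2
  · -- pointwise linear independence
    refine LinearIndependent.of_comp (G p).toLinearMap ?_
    convert b.linearIndependent using 1
    funext i
    exact (hGinv p).self_apply_inverse (b i)
  · -- continuity of the tangent components, in the trivialisation at each `p₀`
    rw [continuous_iff_continuousAt]
    intro p₀
    rw [show (fun p : N => (TotalSpace.mk' (EuclideanSpace ℝ (Fin 4)) p
        ((G p).inverse (b i)).1 : TangentBundle (𝓡 4) N)) = fun p : N =>
          TotalSpace.mk' (EuclideanSpace ℝ (Fin 4)) p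
            ((fun q : N => (((G q).inverse (b i)).1 : TangentSpace (𝓡 4) q)) p) from rfl,
      FiberBundle.continuousAt_section]
    obtain ⟨Gt, hGtc, hGteq⟩ := hread i p₀
    have h1 : ContinuousAt (fun p => ((Gt p).inverse (b i)).1) p₀ := hGtc.fst
    refine h1.congr ?_
    filter_upwards [hGteq] with p hp
    rw [← hp]
    rfl
  · -- continuity of the real components
    rw [continuous_iff_continuousAt]
    intro p₀
    obtain ⟨Gt, hGtc, hGteq⟩ := hread i p₀
    have h1 : ContinuousAt (fun p => ((Gt p).inverse (b i)).2) p₀ := hGtc.snd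
    refine h1.congr ?_
    filter_upwards [hGteq] with p hp
    rw [← hp]

end Summit.SmoothPoincare4.SmoothPoincare4.Theorems.FoldedSphereFoldExistence

end
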